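import Literature.Topology.FourManifolds.GaussDiagramsRegularPosition
import HarnessLib

/-!
# A regular projection puts the knot in general position

Supplement to `GaussDiagramsReadOff.lean` (the read-off of a Gauss diagram from a knot
`Knot.InGeneralPosition`: `InGeneralPosition.regularProjection`) and `GaussDiagrams.lean`
(the bundled witness `Knot.RegularProjection`): the converse direction,
`Knot.RegularProjection.inGeneralPosition` — **a knot that has a regular projection is in general
position** (misses the pole, its stereographic plane curve is an immersion, double points are
transverse, there is no triple point). The two structures carry the same data in different
packaging; this direction is the one needed to start from an ARBITRARY regular projection `P` of a
knot (as in `Knot.HasGaussDiagram`, `Knot.HasRasmussenInvariant`) and apply the general-position API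
(IFT germs at crossings, `crossingSet`, perturbation lemmas) to it — the 0-parameter input of any
Reidemeister-type argument for Gauss diagrams (cf. the named fact `Knot.reidemeisterR`,
`RasmussenWellDefinedR.lean`). Proof: the fields `northPole_notMem`, `deriv_ne_zero`,
`eq_or_crossing` and `det_ne_zero` of a regular projection, read through the `2π`-periodicity of
the plane curve; for the absence of triple points, two crossings through a common parameter are the
same chord read at the same lift, hence have the same partner.

Everything is proved; no definition and no named fact is introduced.

## References

* K. Reidemeister, *Knotentheorie* (1932), Kap. I §1 (regular projections). [cite: Reidemeister1932]
* P. R. Cromwell, *Knots and Links* (2004), §3.2 (general position of diagrams). [cite: Cromwell2004]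
-/

noncomputable section

open scoped Manifold ContDiff
open Set Function

namespace Literature.Topology.FourManifolds

namespace Knot.RegularProjection

variable {K : Knot} (P : K.RegularProjection)

/-- Positions of a regular projection whose parameters are congruent modulo `2π` are equal
(all parameters lie in one period window, `lt_add_two_pi`). [folklore] -/
theorem pos_eq_of_theta_eq_add {p q : Fin (2 * P.diagram.n)} {m : ℤ}
    (h : P.θ p = P.θ q + m * (2 * Real.pi)) : p = q := by
  have h1 := P.lt_add_two_pi p q
  have h2 := P.lt_add_two_pi q p
  have hπ := Real.pi_pos
  have hm1 : (m : ℝ) < 1 := by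
    by_contra hc
    push Not at hc
    nlinarith
  have hm2 : (-1 : ℝ) < m := by
    by_contra hc
    push Not at hc
    nlinarith
  have hm : m = 0 := by
    have : (m : ℤ) < 1 := by exact_mod_cast hm1
    have : (-1 : ℤ) < m := by exact_mod_cast hm2
    omega
  subst hm
  simp only [Int.cast_zero, zero_mul, add_zero] at h
  exact P.injective_θ h

/-- A position belongs to exactly one chord. [folklore] -/
theorem chord_eq_of_pos_eq {i j : Fin P.diagram.n} {p q : Fin (2 * P.diagram.n)}
    (hp : p = P.diagram.overPos i ∨ p = P.diagram.underPos i)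
    (hq : q = P.diagram.overPos j ∨ q = P.diagram.underPos j) (hpq : p = q) : i = j := by
  have hinj := P.diagram.bijective.injective
  subst hpq
  rcases hp with rfl | rfl <;> rcases hq with h | h
  · exact Sum.inl_injective (hinj (a₁ := .inl i) (a₂ := .inl j) h)
  · exact absurd (hinj (a₁ := .inl i) (a₂ := .inr j) h) Sum.inl_ne_inr
  · exact absurd (hinj (a₁ := .inr i) (a₂ := .inl j) h) Sum.inr_ne_inl
  · exact Sum.inr_injective (hinj (a₁ := .inr i) (a₂ := .inr j) h)

/-- The two passages of a chord have different parameters. [folklore] -/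
theorem theta_overPos_ne_underPos (i : Fin P.diagram.n) :
    P.θ (P.diagram.overPos i) ≠ P.θ (P.diagram.underPos i) := by
  intro h
  have := P.injective_θ h
  exact absurd (P.diagram.bijective.injective (a₁ := .inl i) (a₂ := .inr i) this) Sum.inl_ne_inr

omit P in
/-- Antisymmetry of the planar cross product. [folklore] -/
private theorem cross_swap' (u v : ℝ × ℝ) : cross v u = -cross u v := by
  simp only [cross]; ring

/-- Membership in the pair of parameters of chord `i`, with the position extracted. [folklore] -/
theorem exists_pos_of_mem_pair {x : ℝ} {i : Fin P.diagram.n}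
    (hx : x ∈ ({P.θ (P.diagram.overPos i), P.θ (P.diagram.underPos i)} : Set ℝ)) :
    ∃ p, (p = P.diagram.overPos i ∨ p = P.diagram.underPos i) ∧ P.θ p = x := by
  rcases hx with h | h
  · exact ⟨_, Or.inl rfl, h.symm⟩
  · exact ⟨_, Or.inr rfl, (Set.mem_singleton_iff.1 h).symm⟩

/-- **A knot with a regular projection is in general position**: it misses the north pole, its
stereographic plane curve is an immersion with transverse double points and no triple point
(converse of `Knot.InGeneralPosition.regularProjection`). Reidemeister (1932), Kap. I §1;
Cromwell (2004), §3.2. [cite: Reidemeister1932] -/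
theorem inGeneralPosition (P : K.RegularProjection) : K.InGeneralPosition := by
  have hdper := periodic_deriv_of_periodic K.periodic_planeCurve
  refine ⟨fun x hx ↦ P.northPole_notMem ⟨x, hx⟩, P.deriv_ne_zero, fun s t hst ↦ ?_,
    fun s t u hsu htu ↦ ?_⟩
  · rcases P.eq_or_crossing s t hst with ⟨k, rfl⟩ | ⟨i, k, l, hset⟩
    · exact Or.inl (periodic_circlePoint.int_mul k s).symm
    · right
      have hdet := P.det_ne_zero i
      rw [← cross_eq_det] at hdet
      rw [← (hdper.int_mul k) s, ← (hdper.int_mul l) t]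
      rcases Set.pair_eq_pair_iff.1 hset with ⟨h1, h2⟩ | ⟨h1, h2⟩
      · rwa [h1, h2]
      · rw [h1, h2, cross_swap']
        exact neg_ne_zero.2 hdet
  · by_contra hcon
    push Not at hcon
    obtain ⟨hst', htu', hsu'⟩ := hcon
    rcases P.eq_or_crossing s u hsu with ⟨k, rfl⟩ | ⟨i, k, l, hi⟩
    · exact hsu' (periodic_circlePoint.int_mul k s).symm
    rcases P.eq_or_crossing t u htu with ⟨k', rfl⟩ | ⟨j, k', l', hj⟩
    · exact htu' (periodic_circlePoint.int_mul k' t).symm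
    have hu1 : u + l * (2 * Real.pi) ∈
        ({P.θ (P.diagram.overPos i), P.θ (P.diagram.underPos i)} : Set ℝ) := by
      rw [← hi]; simp
    have hu2 : u + l' * (2 * Real.pi) ∈
        ({P.θ (P.diagram.overPos j), P.θ (P.diagram.underPos j)} : Set ℝ) := by
      rw [← hj]; simp
    obtain ⟨p, hp, hpu⟩ := P.exists_pos_of_mem_pair hu1
    obtain ⟨q, hq, hqu⟩ := P.exists_pos_of_mem_pair hu2
    have hpq : p = q :=
      P.pos_eq_of_theta_eq_add (m := l - l') (by rw [hpu, hqu]; push_cast; ring)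
    have hij : i = j := P.chord_eq_of_pos_eq hp hq hpq
    subst hij
    have hll : l = l' := by
      have h2π : (2 * Real.pi) ≠ 0 := by positivity
      have : (l : ℝ) * (2 * Real.pi) = l' * (2 * Real.pi) := by
        have := hpq ▸ hpu
        linarith [this, hqu]
      exact_mod_cast mul_right_cancel₀ h2π this
    subst hll
    have hab := P.theta_overPos_ne_underPos i
    have hst_eq : s + k * (2 * Real.pi) = t + k' * (2 * Real.pi) := by
      rcases Set.pair_eq_pair_iff.1 hi with ⟨h1, h2⟩ | ⟨h1, h2⟩ <;>
        rcases Set.pair_eq_pair_iff.1 hj with ⟨h3, h4⟩ | ⟨h3, h4⟩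
      · rw [h1, h3]
      · exact absurd (h4.symm.trans h2) hab
      · exact absurd (h2.symm.trans h4) hab
      · rw [h1, h3]
    apply hst'
    have : s = t + ((k' - k : ℤ) : ℝ) * (2 * Real.pi) := by push_cast; linarith
    rw [this]
    exact periodic_circlePoint.int_mul _ t

/-- In particular the Gauss diagram read off from the general position of a regular projection is a
Gauss diagram of the knot (`InGeneralPosition.hasGaussDiagram`). [folklore] -/
theorem hasGaussDiagram_gaussDiagram_inGeneralPosition (P : K.RegularProjection) :
    K.HasGaussDiagram P.inGeneralPosition.gaussDiagram :=
  P.inGeneralPosition.hasGaussDiagram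

end Knot.RegularProjection

end Literature.Topology.FourManifolds
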